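import Summits.RiemannHypothesis.RiemannHypothesis.Theses.OddSector
import Summits.RiemannHypothesis.RiemannHypothesis.Theorems.OddSectorOddOneSignedWindowsImpliesRH
import Summits.RiemannHypothesis.RiemannHypothesis.Theorems.OddSectorOddOneSignedWindowsEnergyFloorCore
import Summits.RiemannHypothesis.RiemannHypothesis.Theorems.OddSectorOddOneSignedWindowsExistence
import Summits.RiemannHypothesis.RiemannHypothesis.Theorems.OddSectorOddOneSignedWindowsBulkIff
import Literature.NumberTheory.LFunctions.WeilOddGroundState
import HarnessLib

/-!
# Decomposition census, EXEMPT-46 re-exam r1 — crux `OddSector.OddOneSignedWindows`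
# (stmt-RiemannHypothesis-17778), typed companion of `STRATEGY-CENSUS.md` §"EXEMPT-46 re-exam"

Crux-strategist seat `planner-cstrat-stmt-RiemannHypothesis-17778-r1-0`, 2026-08-17. No `sorry`.
Open statements are `def … : Prop`; everything named `theorem` is kernel-checked.

Write `S := OddOneSignedWindows`, `RH := RiemannHypothesis`. In tree: `S → RH`
(`oddOneSignedWindows_imp_riemannHypothesis`, flag `summit_equivalent/implies_summit` on the item) and
`RH ↔ EFW`, `EFW :=` "energy-floor windows" (`riemannHypothesis_iff_energyFloorWindows`).

The re-exam asks for pieces `X₁ … X_k` with (a) `k ≥ 2` load-bearing, (b) `X₁ → … → X_k → S` PROVED,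
(c) no piece gives `S` or the Statement on its own (cheap probes fail, no landed iff, no
`summit_equivalent` flag), (d) a plan (skeleton / live line) for every open piece — plus RULE-N: at
least two OPEN pieces. This file contains

* §1 the three generic obstruction lemmas that sort every candidate: `piece_imp_rh_of_imp_crux`
  (a piece that gives `S` gives the Statement), `residual_imp_rh` (RULE-N: once the other pieces are
  theorems the residual piece implies `RH` by itself), `piece_imp_rh_of_imp_efw` +
  `weilOddGroundEnergy_nonneg_of_relTight` (every piece that pins the odd ground energy from below —
  in particular every RELATIVE-precision energy statement such as the live line's `TightBlock`
  clause (i) — gives the Statement on its own: (c) fails in substance and the `summit_equivalent`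
  flag follows as soon as the ≈ 30-line certificate lands);
* §2 the assemblies (b) of the candidates that are not already in the tree — the balanced ZONE
  PARTITION (D-E: `oddOneSignedWindows_of_zone`, `zoneBridge_of_zonePropagation`) and the CASE SPLIT
  (D-F: `oddOneSignedWindows_of_cases`) — so that (b) is visibly not the obstacle; their (c) probes are
  run in `bc/*.lean` (outputs quoted in the census) and their failure is (d);
* §3 the certificates that kill the remaining candidates under (c): `decompA_piece_gives_statement`
  (bridge through `RH` by name), `notRH_case_iff_rh` (case split on `RH`), the landed iffs (D-B).
-/

noncomputable section

set_option linter.dupNamespace false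

open MeasureTheory Set Filter
open scoped Topology

namespace Summit.RiemannHypothesis.RiemannHypothesis.Cruxes.OddOneSignedWindows.Strategist3

open Literature.NumberTheory.LFunctions
open Summit.RiemannHypothesis.RiemannHypothesis.Theses.OddSector
open Summit.RiemannHypothesis.RiemannHypothesis.Theorems.OddSector

/-! ## 0. Vocabulary (all over tree declarations) -/

/-- `Good a`: the window `a` carries an odd-sector ground state that is real and `≥ 0` a.e. on
`(0, a)` — the matrix of the crux (`crux_iff_good`). -/
def Good (a : ℝ) : Prop :=
  ∃ u : ℝ → ℂ, IsWeilOddGroundState a u ∧ ∀ᵐ t : ℝ, t ∈ Ioo 0 a → (u t).im = 0 ∧ 0 ≤ (u t).re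

/-- `LayerGood η κ a`: the window `a` carries an odd-sector ground state that is real and `≥ 0`
a.e. on the ORIGIN LAYER `(0, η)` and on the EDGE LAYER `(a - κ, a)` (nothing asked on the bulk). -/
def LayerGood (η κ a : ℝ) : Prop :=
  ∃ u : ℝ → ℂ, IsWeilOddGroundState a u ∧
    ∀ᵐ t : ℝ, t ∈ Ioo 0 η ∪ Ioo (a - κ) a → (u t).im = 0 ∧ 0 ≤ (u t).re

/-- `EFW` — energy-floor windows: `∃ e → 0, ∀ A ∃ a ≥ A, -e(a) ≤ ε_od(a)`. In tree `RH ↔ EFW`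
(`riemannHypothesis_iff_energyFloorWindows`, Theorems/…EnergyFloorCore, p158516). -/
def EnergyFloorWindows : Prop :=
  ∃ e : ℝ → ℝ, Tendsto e atTop (nhds 0) ∧ ∀ A : ℝ, ∃ a : ℝ, A ≤ a ∧ -e a ≤ weilOddGroundEnergy a

/-- The crux is "good windows beyond every height" (definitional). [folklore] -/
theorem crux_iff_good : OddOneSignedWindows ↔ ∀ A : ℝ, ∃ a : ℝ, A ≤ a ∧ Good a := by
  unfold Good; exact oddOneSignedWindows_iff

/-- `EFW ↔ RH` (restated from the tree). [folklore] -/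
theorem efw_iff_rh : EnergyFloorWindows ↔ _root_.RiemannHypothesis :=
  riemannHypothesis_iff_energyFloorWindows.symm

/-! ## 1. Generic obstruction lemmas -/

/-- **(c), first half.** A piece that gives the crux gives the Statement: `(T → S) → (T → RH)`.
[folklore] -/
theorem piece_imp_rh_of_imp_crux {T : Prop} (h : T → OddOneSignedWindows) :
    T → _root_.RiemannHypothesis :=
  fun t => oddOneSignedWindows_imp_riemannHypothesis (h t)

/-- **RULE-N.** In any split `X₁ → X₂ → S` whose first piece is a theorem, the residual piece
implies the Statement by itself — so a split with ONE open piece is the crux restated one level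
down. (Instances on file: `DiophantineSelection` p154064 ∧ `DiophantineCore`;
`OriginLayerLemma` p151407 ∧ `OddBulkSignPattern`; existence p142733 ∧ "all/one ground state
one-signed i.o."; and, prospectively, the live line once its RH-free stubs land.) [folklore] -/
theorem residual_imp_rh {X₁ X₂ : Prop} (h : X₁ → X₂ → OddOneSignedWindows) (h₁ : X₁) :
    X₂ → _root_.RiemannHypothesis :=
  fun h₂ => oddOneSignedWindows_imp_riemannHypothesis (h h₁ h₂)

/-- Three-piece form of RULE-N (two RH-free pieces banked, the third is `≥` the Statement).
[folklore] -/
theorem residual_imp_rh₃ {X₁ X₂ X₃ : Prop} (h : X₁ → X₂ → X₃ → OddOneSignedWindows) (h₁ : X₁)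
    (h₂ : X₂) : X₃ → _root_.RiemannHypothesis :=
  fun h₃ => oddOneSignedWindows_imp_riemannHypothesis (h h₁ h₂ h₃)

/-- **(c), second half: energy pieces.** A piece that yields energy-floor windows gives the
Statement on its own (`RH ↔ EFW` in tree). [folklore] -/
theorem piece_imp_rh_of_imp_efw {T : Prop} (h : T → EnergyFloorWindows) :
    T → _root_.RiemannHypothesis :=
  fun t => efw_iff_rh.1 (h t)

/-- **Relative tightness forces a non-negative infimum** (abstract core of the live line's strength
certificate `stub_tightBlockNonneg`): if every lower bound `R` of a nonempty bounded-below set `E`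
improves to the lower bound `R/(1+θ)`, `θ > 0`, then `inf E ≥ 0` (take `R := inf E`).
[folklore] -/
theorem sInf_nonneg_of_relTight {E : Set ℝ} (hne : E.Nonempty) (hbdd : BddBelow E) {θ : ℝ}
    (hθ : 0 < θ) (h : ∀ R : ℝ, (∀ e ∈ E, R ≤ e) → ∀ e ∈ E, R / (1 + θ) ≤ e) : 0 ≤ sInf E := by
  have h1 : ∀ e ∈ E, sInf E / (1 + θ) ≤ e := h (sInf E) (fun e he => csInf_le hbdd he)
  have h2 : sInf E / (1 + θ) ≤ sInf E := le_csInf hne h1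
  have hpos : (0 : ℝ) < 1 + θ := by linarith
  have h3 : sInf E ≤ sInf E * (1 + θ) := (div_le_iff₀ hpos).1 h2
  by_contra hneg
  have hneg' : sInf E < 0 := lt_of_not_ge hneg
  nlinarith

/-- **Every relative-precision energy statement pins `ε_od(a) ≥ 0`.** If at a window `a > 0` every
lower bound `R` of `Re Q` on the odd unit sphere improves to `R/(1+θ)` (`θ > 0`; this is clause (i)
of the live line's `Tight θ' Δ K a` with `θ = θ'e^{-4a}`, whose admissible `R` range — closed-energy
lower bounds of the block span — contains every lower bound of the sphere), then
`0 ≤ weilOddGroundEnergy a`. With `weilOddGroundEnergy_antitone` and the landed odd criterion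
(`riemannHypothesis_iff_forall_weilOddGroundEnergy_nonneg`) such a piece holding at cofinal
windows IS the Statement plus decoration: (c) fails in substance for it. [folklore] -/
theorem weilOddGroundEnergy_nonneg_of_relTight {a θ : ℝ} (ha : 0 < a) (hθ : 0 < θ)
    (h : ∀ R : ℝ,
      (∀ g : ℝ → ℂ, IsWeilTest g → tsupport g ⊆ Icc (-a) a → (∀ t, g (-t) = -g t) →
        ∫ t, ‖g t‖ ^ 2 = (1 : ℝ) → R ≤ (weilQuadratic g).re) →
      ∀ g : ℝ → ℂ, IsWeilTest g → tsupport g ⊆ Icc (-a) a → (∀ t, g (-t) = -g t) →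
        ∫ t, ‖g t‖ ^ 2 = (1 : ℝ) → R / (1 + θ) ≤ (weilQuadratic g).re) :
    0 ≤ weilOddGroundEnergy a := by
  unfold weilOddGroundEnergy
  refine sInf_nonneg_of_relTight ?_ (bddBelow_weilQuadratic_oddSphere a) hθ ?_
  · obtain ⟨g, hg, hsupp, hodd, hnorm⟩ := exists_isWeilTest_odd_sphere ha
    exact ⟨_, g, hg, hsupp, hodd, hnorm, rfl⟩
  · rintro R hR x ⟨g, hg, hsupp, hodd, hnorm, rfl⟩
    refine h R ?_ g hg hsupp hodd hnorm
    intro g' hg' hsupp' hodd' hnorm'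
    exact hR _ ⟨g', hg', hsupp', hodd', hnorm', rfl⟩

/-- **Cofinal relative tightness is the Statement** (the shape of the live line's K1,
`stub_tightBlockEventually`, after clause (i) is read through
`weilOddGroundEnergy_nonneg_of_relTight`): non-negativity of `ε_od` at cofinal windows is RH, by
antitonicity and the odd criterion — both in tree. [folklore] -/
theorem riemannHypothesis_of_cofinal_nonneg
    (h : ∀ B : ℝ, ∃ a : ℝ, B ≤ a ∧ 0 ≤ weilOddGroundEnergy a) : _root_.RiemannHypothesis := by
  rw [riemannHypothesis_iff_forall_weilOddGroundEnergy_nonneg]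
  intro b hb
  obtain ⟨a, hba, h0⟩ := h b
  exact h0.trans (weilOddGroundEnergy_antitone hb hba)

/-- Conversely the Statement gives cofinal (indeed global) non-negativity, so a cofinal
non-negativity piece is EQUIVALENT to the Statement. [folklore] -/
theorem cofinal_nonneg_iff_rh :
    (∀ B : ℝ, ∃ a : ℝ, B ≤ a ∧ 0 ≤ weilOddGroundEnergy a) ↔ _root_.RiemannHypothesis :=
  ⟨riemannHypothesis_of_cofinal_nonneg, fun hRH B =>
    ⟨B, le_rfl, riemannHypothesis_iff_forall_weilOddGroundEnergy_nonneg'.1 hRH B⟩⟩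

/-! ## 2. Assemblies of the candidates that are not in the tree -/

/-! ### D-E. The balanced ZONE PARTITION (new in this re-exam)

`X₁ = ZoneBridge η κ` ("beyond some height, a LAYER-good window is good": the bulk sign follows
from the layer signs) and `X₂ = LayerGoodWindows η κ` ("layer-good windows beyond every height").
Neither piece is known to give `RH` alone (`¬RH ⟹` eventually no GOOD window, which is consistent
with each piece separately), neither gives `S` cheaply (probes `bc/ZoneBridge_*.lean`,
`bc/LayerGoodWindows_*.lean`: all FAIL), no iff is landed, `X₂` is a consequence of `S`
(`layerGoodWindows_of_crux`) used toward `S`. (a) (b) (c) pass; (d) fails — see the census. -/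

/-- `X₁` of D-E. -/
def ZoneBridge (η κ : ℝ) : Prop :=
  ∃ a₀ : ℝ, ∀ a : ℝ, a₀ ≤ a → LayerGood η κ a → Good a

/-- `X₂` of D-E. -/
def LayerGoodWindows (η κ : ℝ) : Prop :=
  ∀ A : ℝ, ∃ a : ℝ, A ≤ a ∧ LayerGood η κ a

/-- The pointwise form of `X₁` (same ground state): layer signs propagate into the bulk. -/
def ZonePropagation (η κ : ℝ) : Prop :=
  ∃ a₀ : ℝ, ∀ a : ℝ, a₀ ≤ a → ∀ u : ℝ → ℂ, IsWeilOddGroundState a u →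
    (∀ᵐ t : ℝ, t ∈ Ioo 0 η ∪ Ioo (a - κ) a → (u t).im = 0 ∧ 0 ≤ (u t).re) →
    (∀ᵐ t : ℝ, t ∈ Icc η (a - κ) → (u t).im = 0 ∧ 0 ≤ (u t).re)

/-- **(b) for D-E**: the assembly `X₁ → X₂ → S`, proved (a four-line seam: `trivial_seam`).
[folklore] -/
theorem oddOneSignedWindows_of_zone {η κ : ℝ} (h₁ : ZoneBridge η κ) (h₂ : LayerGoodWindows η κ) :
    OddOneSignedWindows := by
  rw [crux_iff_good]
  intro A
  obtain ⟨a₀, hbridge⟩ := h₁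
  obtain ⟨a, ha, hlayer⟩ := h₂ (max A a₀)
  exact ⟨a, le_trans (le_max_left _ _) ha, hbridge a (le_trans (le_max_right _ _) ha) hlayer⟩

/-- The pointwise form implies the window form of `X₁` (a.e. bookkeeping on
`(0,a) = (0,η) ∪ [η, a-κ] ∪ (a-κ, a)`). [folklore] -/
theorem zoneBridge_of_zonePropagation {η κ : ℝ} (h : ZonePropagation η κ) : ZoneBridge η κ := by
  obtain ⟨a₀, h⟩ := h
  refine ⟨a₀, fun a ha hlg => ?_⟩
  obtain ⟨u, hu, hlay⟩ := hlg
  refine ⟨u, hu, ?_⟩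
  have hbulk := h a ha u hu hlay
  filter_upwards [hlay, hbulk] with t ht hb htI
  by_cases h1 : t < η
  · exact ht (Or.inl ⟨htI.1, h1⟩)
  · by_cases h2 : a - κ < t
    · exact ht (Or.inr ⟨h2, htI.2⟩)
    · exact hb ⟨not_lt.1 h1, not_lt.1 h2⟩

/-- `S`-side probe of D-E (informational, BC2 "run the converse"): a good window is layer-good,
so `X₂` is a CONSEQUENCE of the crux (for layers inside the window). [folklore] -/
theorem layerGood_of_good {η κ a : ℝ} (hηa : η ≤ a) (hκ : 0 ≤ a - κ) (h : Good a) :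
    LayerGood η κ a := by
  obtain ⟨u, hu, hs⟩ := h
  refine ⟨u, hu, ?_⟩
  filter_upwards [hs] with t ht htU
  rcases htU with h1 | h2
  · exact ht ⟨h1.1, h1.2.trans_le hηa⟩
  · exact ht ⟨hκ.trans_lt h2.1, h2.2⟩

/-- Hence `S → X₂` for every fixed pair of layer widths. [folklore] -/
theorem layerGoodWindows_of_crux {η κ : ℝ} (hS : OddOneSignedWindows) :
    LayerGoodWindows η κ := by
  rw [crux_iff_good] at hS
  intro A
  obtain ⟨a, ha, hgood⟩ := hS (max A (max η κ))
  refine ⟨a, le_trans (le_max_left _ _) ha, layerGood_of_good ?_ ?_ hgood⟩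
  · exact le_trans (le_trans (le_max_left _ _) (le_max_right _ _)) ha
  · have : κ ≤ a := le_trans (le_trans (le_max_right _ _) (le_max_right _ _)) ha
    linarith

/-- And the conjunction of the two D-E pieces is at least the Statement (as every assembly of `S`
must be) — but only the CONJUNCTION: this is the one candidate on file where the `RH`-content is not
carried by a single piece. [folklore] -/
theorem riemannHypothesis_of_zone {η κ : ℝ} (h₁ : ZoneBridge η κ) (h₂ : LayerGoodWindows η κ) :
    _root_.RiemannHypothesis :=
  oddOneSignedWindows_imp_riemannHypothesis (oddOneSignedWindows_of_zone h₁ h₂)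

/-! ### D-F. CASE SPLITS `S ⇐ (P → S) ∧ (¬P → S)` -/

/-- **(b) for D-F**: excluded middle. [folklore] -/
theorem oddOneSignedWindows_of_cases (P : Prop) (h₁ : P → OddOneSignedWindows)
    (h₂ : ¬P → OddOneSignedWindows) : OddOneSignedWindows := by
  by_cases hP : P
  · exact h₁ hP
  · exact h₂ hP

/-- **(c) kills the instance `P = RH`**: the piece `¬RH → S` IS the Statement
(and the other piece `RH → S` is the beyond-summit conjunct `C`, irrefutable short of RH).
[folklore] -/
theorem notRH_case_iff_rh :
    (¬ _root_.RiemannHypothesis → OddOneSignedWindows) ↔ _root_.RiemannHypothesis :=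
  ⟨fun h => Classical.byContradiction fun hn =>
      hn (oddOneSignedWindows_imp_riemannHypothesis (h hn)),
    fun h hn => absurd h hn⟩

/-- For a general dichotomy `P` each case-piece is weaker than `S` (so (c) passes by the letter);
but the `P`-branch is the bridge `P ∧ (P → S)` in disguise as soon as `¬P` is excluded by proving
`P` — and then RULE-N applies (`residual_imp_rh`). [folklore] -/
theorem case_split_collapses {P : Prop} (hP : P) (h₁ : P → OddOneSignedWindows) :
    _root_.RiemannHypothesis :=
  residual_imp_rh (fun (p : P) (h : P → OddOneSignedWindows) => h p) hP h₁

/-! ## 3. Certificates for the candidates killed by (c) outright -/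

/-- **D-A (bridge through the summit by name, incl. the r2 card's `X ↔ RH ∧ NII′`)**: assembly.
[folklore] -/
theorem decompA_assembly (h₁ : _root_.RiemannHypothesis)
    (h₂ : _root_.RiemannHypothesis → OddOneSignedWindows) : OddOneSignedWindows := h₂ h₁

/-- D-A fails (c): the piece `RH` gives the Statement by `exact` (the cheap probe succeeds). -/
theorem decompA_piece_gives_statement (h : _root_.RiemannHypothesis) :
    _root_.Summit.RiemannHypothesis := h

/-- D-A, energy-coded variants fail (c) by LANDED IFF: `(∀ a > 0, 0 ≤ ε_od a) ↔ RH`,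
`EFW ↔ RH`, cofinal non-negativity `↔ RH` (`cofinal_nonneg_iff_rh` above). [folklore] -/
theorem decompA'_landed_iffs :
    ((∀ a : ℝ, 0 < a → 0 ≤ weilOddGroundEnergy a) ↔ _root_.RiemannHypothesis) ∧
    (EnergyFloorWindows ↔ _root_.RiemannHypothesis) :=
  ⟨riemannHypothesis_iff_forall_weilOddGroundEnergy_nonneg.symm, efw_iff_rh⟩

/-- **D-B (equivalent reformulations) fails (c) by LANDED IFF**: the robust bulk form
(`stub_oddOneSignedWindows_iff_bulkSignPattern`, p151717; likewise `NoOpposedReflections` p150975,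
the real-valued form `oddOneSignedWindows_iff_real_nonneg`, `S ↔ S ∧ RH`). [folklore] -/
theorem decompB_landed_iff :
    OddOneSignedWindows ↔
      ∀ A : ℝ, ∃ a : ℝ, A ≤ a ∧ 1 ≤ a ∧ ∃ u : ℝ → ℂ, IsWeilOddGroundState a u ∧
        (∀ t, (u t).im = 0) ∧
        (∀ᵐ t : ℝ, t ∈ Ico (1 / 20 : ℝ) a → 0 ≤ (u t).re) ∧
        (∀ᵐ x : ℝ, x ∈ Ioo (0 : ℝ) (1 / 20) → (u x).re < 0 →
          layerPrimeDefect a u x ≤ layerArchGlue a (1 / 20) u x) :=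
  stub_oddOneSignedWindows_iff_bulkSignPattern

end Summit.RiemannHypothesis.RiemannHypothesis.Cruxes.OddOneSignedWindows.Strategist3

end
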